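import Literature.Combinatorics.Enumerative.DistinctPartitionsBound
import Mathlib.NumberTheory.ZetaValues
import Mathlib.Analysis.SpecialFunctions.Log.Deriv
import Mathlib.Analysis.SpecialFunctions.Trigonometric.DerivHyp
import HarnessLib

/-!
# The sharp exponential order for partitions into distinct parts: `P_D(A) ≤ e^{π√(A/3)}`

Topic `Literature/Combinatorics/Enumerative` (continues `DistinctPartitionsBound.lean`, which proves
the elementary `#{S : ΣS ≤ n} ≤ e^{3√n}`). Hardy–Ramanujan (1917): `log P_D(A) ∼ π (A/3)^{1/2}` for
the number `P_D(A)` of partitions of `A` into distinct parts (Madras–Slade, *The Self-Avoiding Walk*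
(1993), Theorem 3.1.4, p. 58: "This theorem is proved in Hardy and Ramanujan (1917)"). This file PROVES
the upper half with the SHARP constant and no error term, in the form the Hammersley–Welsh argument
consumes (Madras–Slade (3.1.6): "`P_D(A) ≤ K exp[(B - ε)(A/2)^{1/2}]` for all `A`", any
`B - ε > π(2/3)^{1/2}`):

* `sum_log_one_add_exp_le` — for `t > 0`: `Σ_{k=1}^{n} log(1 + e^{-kt}) ≤ π²/(12 t)`;
* `card_finsetsOfSumLE_le_exp_sharp` — **`#{S ⊆ ℕ_{>0} finite : ΣS ≤ n} ≤ exp(π √(n/3))`** for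
  every `n`, hence `card_distinctPartitions_le_exp_sharp : P_D(A) ≤ exp(π √(A/3))`.

Proof (elementary; positive series only). With `x = e^{-t}`: `1 + x^k = (1 - x^{2k})/(1 - x^k)`, so
`log(1 + x^k) = L(x^k) - L(x^{2k})` with `L(y) = -log(1-y) = Σ_{j≥1} y^j/j` (Mathlib
`Real.hasSum_pow_div_log_of_abs_lt_one`); summing over `k ≤ n` and exchanging with the `j`-sum,
`Σ_k log(1+x^k) = Σ_j (1/j) Σ_{k≤n} (y_j^k - y_j^{2k})` with `y_j = x^j`, and since every term
`y^k - y^{2k} ≥ 0`, `Σ_{k≤n}(y^k - y^{2k}) ≤ Σ_{k≥1}(y^k - y^{2k}) = y/(1-y) - y²/(1-y²) = y/(1-y²)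
= 1/(2 sinh(jt)) ≤ 1/(2jt)`; hence `Σ_k log(1+x^k) ≤ (1/2t) Σ_j 1/j² = π²/(12t)` (Mathlib
`hasSum_zeta_two`). Finally `#{S} xⁿ ≤ Σ_{S ⊆ {1..n}} x^{ΣS} = Π_{k≤n}(1+x^k)`
(`sum_pow_sum_eq_prod`) and `t = π/(2√(3n))` gives `nt + π²/(12t) = π√(n/3)`.

## References

* N. Madras, G. Slade, *The Self-Avoiding Walk* (1993), Theorem 3.1.4 (p. 58) and (3.1.6) (p. 60).
  [MadrasSlade1993]
* G. H. Hardy, S. Ramanujan, *Asymptotic formulae in combinatory analysis*, Proc. LMS 17 (1918) 75–115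
  (cited through Madras–Slade).
-/

noncomputable section

open Finset Real
open scoped BigOperators

namespace Literature.Combinatorics.Enumerative

/-! ### The analytic core: `Σ_{k=1}^{n} log(1 + e^{-kt}) ≤ π²/(12t)` -/

/-- For `0 ≤ y < 1`: `Σ_{k=1}^{n} (y^k - y^{2k}) ≤ y/(1 - y²)` (every term is nonnegative and the
full series sums to `y/(1-y) - y²/(1-y²) = y/(1-y²)`).
[cite: MadrasSlade1993, Theorem 3.1.4 (proof ingredient of the sharp upper bound)] -/
theorem sum_pow_sub_pow_two_mul_le {y : ℝ} (hy0 : 0 ≤ y) (hy1 : y < 1) (n : ℕ) :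
    ∑ k ∈ Icc 1 n, (y ^ k - y ^ (2 * k)) ≤ y / (1 - y ^ 2) := by
  have hy2 : y ^ 2 < 1 := by nlinarith
  have hy20 : 0 ≤ y ^ 2 := sq_nonneg y
  -- the two geometric series over `k ≥ 1`
  have hgeo : ∀ z : ℝ, 0 ≤ z → z < 1 → HasSum (fun k : ℕ => z ^ (k + 1)) (z / (1 - z)) := by
    intro z hz0 hz1
    rw [div_eq_mul_inv]
    simpa [pow_succ'] using (hasSum_geometric_of_lt_one hz0 hz1).mul_left z
  have h1 : HasSum (fun k : ℕ => y ^ (k + 1)) (y / (1 - y)) := hgeo y hy0 hy1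
  have h2 : HasSum (fun k : ℕ => (y ^ 2) ^ (k + 1)) (y ^ 2 / (1 - y ^ 2)) := hgeo (y ^ 2) hy20 hy2
  have h3 : HasSum (fun k : ℕ => y ^ (k + 1) - y ^ (2 * (k + 1))) (y / (1 - y) - y ^ 2 / (1 - y ^ 2)) := by
    have := h1.sub h2
    simp_rw [← pow_mul] at this
    exact this
  have hval : y / (1 - y) - y ^ 2 / (1 - y ^ 2) = y / (1 - y ^ 2) := by
    have h1y : (1 : ℝ) - y ≠ 0 := by linarith
    have h1y2 : (1 : ℝ) - y ^ 2 ≠ 0 := by linarith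
    field_simp
    ring
  have hnn : ∀ k : ℕ, 0 ≤ y ^ (k + 1) - y ^ (2 * (k + 1)) := by
    intro k
    rw [sub_nonneg, pow_mul]
    exact pow_le_pow_left₀ hy20 (by nlinarith) _
  -- the finite sum over `Icc 1 n` is the partial sum over `range n` of the shifted sequence
  have hshift : ∑ k ∈ Icc 1 n, (y ^ k - y ^ (2 * k)) =
      ∑ k ∈ Finset.range n, (y ^ (k + 1) - y ^ (2 * (k + 1))) := by
    rw [Finset.range_eq_Ico, ← Finset.Ico_add_one_right_eq_Icc,
      Finset.sum_Ico_add' (fun k => y ^ k - y ^ (2 * k)) 0 n 1]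
  rw [hshift, ← hval]
  exact sum_le_hasSum _ (fun k _ => hnn k) h3

/-- `y/(1 - y²) ≤ 1/(2u)` for `y = e^{-u}`, `u > 0` (i.e. `1/(2 sinh u) ≤ 1/(2u)`, as `sinh u ≥ u`).
[cite: MadrasSlade1993, Theorem 3.1.4 (proof ingredient of the sharp upper bound)] -/
theorem exp_neg_div_one_sub_sq_le {u : ℝ} (hu : 0 < u) :
    Real.exp (-u) / (1 - Real.exp (-u) ^ 2) ≤ 1 / (2 * u) := by
  have hsinh : u ≤ Real.sinh u := Real.self_le_sinh_iff.2 hu.le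
  rw [Real.sinh_eq] at hsinh
  have hepos : 0 < Real.exp u := Real.exp_pos u
  have heneg : Real.exp (-u) = (Real.exp u)⁻¹ := Real.exp_neg u
  have hlt : Real.exp (-u) < 1 := by rw [Real.exp_lt_one_iff]; linarith
  have hden : 0 < 1 - Real.exp (-u) ^ 2 := by nlinarith [Real.exp_pos (-u)]
  rw [div_le_div_iff₀ hden (by positivity)]
  -- `2u e^{-u} ≤ 1 - e^{-2u}` ⟸ `2u ≤ e^{u} - e^{-u}`
  have key : 2 * u ≤ Real.exp u - Real.exp (-u) := by linarith
  have h1 : Real.exp (-u) * Real.exp u = 1 := by rw [heneg, inv_mul_cancel₀ hepos.ne']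
  nlinarith [Real.exp_pos (-u), h1]

/-- **`Σ_{k=1}^{n} log(1 + e^{-kt}) ≤ π²/(12t)`** for `t > 0`: the sharp logarithmic bound on the
generating function `Π_{k≤n}(1 + x^k)` of partitions into distinct parts at `x = e^{-t}`.
[cite: MadrasSlade1993, Theorem 3.1.4 (upper half, Hardy–Ramanujan 1917)] -/
theorem sum_log_one_add_exp_le {t : ℝ} (ht : 0 < t) (n : ℕ) :
    ∑ k ∈ Icc 1 n, Real.log (1 + Real.exp (-t) ^ k) ≤ Real.pi ^ 2 / (12 * t) := by
  set x : ℝ := Real.exp (-t) with hx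
  have hx0 : 0 < x := Real.exp_pos _
  have hx1 : x < 1 := by rw [hx, Real.exp_lt_one_iff]; linarith
  -- `y_j = x^{j+1} = e^{-(j+1)t}`
  have hyj : ∀ j : ℕ, x ^ (j + 1) = Real.exp (-(((j : ℝ) + 1) * t)) := by
    intro j
    rw [hx, ← Real.exp_nat_mul]; congr 1; push_cast; ring
  have hy0 : ∀ j : ℕ, 0 ≤ x ^ (j + 1) := fun j => pow_nonneg hx0.le _
  have hy1 : ∀ j : ℕ, x ^ (j + 1) < 1 := fun j => pow_lt_one₀ hx0.le hx1 (by omega)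
  -- `log(1 + x^k) = L(x^k) - L(x^{2k})`, each as a power series in `j`
  have hL : ∀ k ∈ Icc 1 n, HasSum (fun j : ℕ => ((x ^ k) ^ (j + 1) - (x ^ (2 * k)) ^ (j + 1)) / (j + 1))
      (Real.log (1 + x ^ k)) := by
    intro k hk
    have hxk0 : 0 ≤ x ^ k := pow_nonneg hx0.le _
    have hxk1 : x ^ k < 1 := pow_lt_one₀ hx0.le hx1 (by rw [Finset.mem_Icc] at hk; omega)
    have hx2k1 : x ^ (2 * k) < 1 := pow_lt_one₀ hx0.le hx1 (by rw [Finset.mem_Icc] at hk; omega)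
    have ha := Real.hasSum_pow_div_log_of_abs_lt_one (show |x ^ k| < 1 by rwa [abs_of_nonneg hxk0])
    have hb := Real.hasSum_pow_div_log_of_abs_lt_one
      (show |x ^ (2 * k)| < 1 by rwa [abs_of_nonneg (pow_nonneg hx0.le _)])
    have hab := ha.sub hb
    have hval : -Real.log (1 - x ^ k) - -Real.log (1 - x ^ (2 * k)) = Real.log (1 + x ^ k) := by
      have h1 : 0 < 1 - x ^ k := by linarith
      have h2 : (1 : ℝ) - x ^ (2 * k) = (1 - x ^ k) * (1 + x ^ k) := by ring
      rw [h2, Real.log_mul h1.ne' (by positivity)]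
      ring
    rw [hval] at hab
    refine hab.congr_fun fun j => ?_
    ring
  -- sum over `k`
  have hsum : HasSum (fun j : ℕ => ∑ k ∈ Icc 1 n, ((x ^ k) ^ (j + 1) - (x ^ (2 * k)) ^ (j + 1)) / (j + 1))
      (∑ k ∈ Icc 1 n, Real.log (1 + x ^ k)) := hasSum_sum hL
  -- the dominating series `Σ_j (1/(j+1)) · 1/(2(j+1)t) = (1/(2t)) Σ_j 1/(j+1)²`
  have hzeta : HasSum (fun j : ℕ => (1 : ℝ) / ((j : ℝ) + 1) ^ 2) (Real.pi ^ 2 / 6) := by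
    have h := (hasSum_nat_add_iff' 1).2 hasSum_zeta_two
    simp only [Finset.range_one, Finset.sum_singleton, Nat.cast_zero, ne_eq, OfNat.ofNat_ne_zero,
      not_false_eq_true, zero_pow, div_zero, sub_zero, Nat.cast_add, Nat.cast_one] at h
    exact h
  have hdom : HasSum (fun j : ℕ => (1 / (2 * t)) * (1 / ((j : ℝ) + 1) ^ 2)) (1 / (2 * t) * (Real.pi ^ 2 / 6)) :=
    hzeta.mul_left _
  have hle : ∀ j : ℕ, ∑ k ∈ Icc 1 n, ((x ^ k) ^ (j + 1) - (x ^ (2 * k)) ^ (j + 1)) / (j + 1) ≤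
      (1 / (2 * t)) * (1 / ((j : ℝ) + 1) ^ 2) := by
    intro j
    have hj : (0 : ℝ) < (j : ℝ) + 1 := by positivity
    -- rewrite the summand as `(y^k - y^{2k})/(j+1)` with `y = x^{j+1}`
    have hrw : ∀ k : ℕ, ((x ^ k) ^ (j + 1) - (x ^ (2 * k)) ^ (j + 1)) / (j + 1) =
        ((x ^ (j + 1)) ^ k - (x ^ (j + 1)) ^ (2 * k)) / ((j : ℝ) + 1) := by
      intro k
      rw [← pow_mul, ← pow_mul, ← pow_mul, ← pow_mul]
      congr 2 <;> ring_nf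
    simp_rw [hrw]
    rw [← Finset.sum_div, div_le_iff₀ hj]
    have h1 := sum_pow_sub_pow_two_mul_le (hy0 j) (hy1 j) n
    have h2 : x ^ (j + 1) / (1 - (x ^ (j + 1)) ^ 2) ≤ 1 / (2 * (((j : ℝ) + 1) * t)) := by
      rw [hyj j]
      exact exp_neg_div_one_sub_sq_le (by positivity)
    calc ∑ k ∈ Icc 1 n, ((x ^ (j + 1)) ^ k - (x ^ (j + 1)) ^ (2 * k))
        ≤ 1 / (2 * (((j : ℝ) + 1) * t)) := h1.trans h2
      _ = 1 / (2 * t) * (1 / ((j : ℝ) + 1) ^ 2) * ((j : ℝ) + 1) := by field_simp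
  calc ∑ k ∈ Icc 1 n, Real.log (1 + x ^ k)
      ≤ 1 / (2 * t) * (Real.pi ^ 2 / 6) := hasSum_le hle hsum hdom
    _ = Real.pi ^ 2 / (12 * t) := by field_simp; ring

/-! ### The sharp count bound -/

/-- **The number of finite sets of positive integers with sum at most `n` is at most
`exp(π √(n/3))`** (sharp exponential order, Hardy–Ramanujan): `#{S} e^{-nt} ≤ Π_{k≤n}(1+e^{-kt})
≤ exp(π²/(12t))` with `t = π/(2√(3n))`. [cite: MadrasSlade1993, Theorem 3.1.4 (p. 58; upper half)] -/
theorem card_finsetsOfSumLE_le_exp_sharp (n : ℕ) :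
    ((finsetsOfSumLE n).card : ℝ) ≤ Real.exp (Real.pi * Real.sqrt (n / 3)) := by
  rcases Nat.eq_zero_or_pos n with rfl | hn
  · have h := card_finsetsOfSumLE_le_exp 0
    simp only [CharP.cast_eq_zero, Real.sqrt_zero, mul_zero, Real.exp_zero] at h
    simpa using h
  have hn' : (0 : ℝ) < n := by exact_mod_cast hn
  set s : ℝ := Real.sqrt (3 * n) with hs
  have hs0 : 0 < s := Real.sqrt_pos.2 (by positivity)
  set t : ℝ := Real.pi / (2 * s) with ht
  have ht0 : 0 < t := by positivity
  set x : ℝ := Real.exp (-t) with hx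
  have hx0 : 0 < x := Real.exp_pos _
  have hx1 : x < 1 := by rw [hx, Real.exp_lt_one_iff]; linarith
  -- each set with sum `≤ n` contributes at least `xⁿ`
  have hlow : ((finsetsOfSumLE n).card : ℝ) * x ^ n ≤ ∑ S ∈ (Icc 1 n).powerset, x ^ S.sum id := by
    calc ((finsetsOfSumLE n).card : ℝ) * x ^ n = ∑ S ∈ finsetsOfSumLE n, x ^ n := by
          rw [Finset.sum_const, nsmul_eq_mul]
      _ ≤ ∑ S ∈ finsetsOfSumLE n, x ^ S.sum id :=
          Finset.sum_le_sum fun S hS =>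
            pow_le_pow_of_le_one hx0.le hx1.le (mem_finsetsOfSumLE.1 hS).2
      _ ≤ ∑ S ∈ (Icc 1 n).powerset, x ^ S.sum id :=
          Finset.sum_le_sum_of_subset_of_nonneg (Finset.filter_subset _ _)
            fun _ _ _ => pow_nonneg hx0.le _
  -- the product is at most `exp(π²/(12t))`
  have hprod : ∑ S ∈ (Icc 1 n).powerset, x ^ S.sum id ≤ Real.exp (Real.pi ^ 2 / (12 * t)) := by
    rw [sum_pow_sum_eq_prod]
    have hpos : ∀ k ∈ Icc 1 n, 0 < 1 + x ^ k := fun k _ => by positivity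
    rw [← Real.exp_log (Finset.prod_pos hpos), Real.exp_le_exp, Real.log_prod fun k hk => (hpos k hk).ne']
    exact sum_log_one_add_exp_le ht0 n
  -- `xⁿ = e^{-nt}` and `nt + π²/(12t) = π √(n/3)`
  have hxn : x ^ n = Real.exp (-(n * t)) := by rw [hx, ← Real.exp_nat_mul]; ring_nf
  have hss : s ^ 2 = 3 * n := by rw [hs, Real.sq_sqrt (by positivity)]
  have hkey : n * t + Real.pi ^ 2 / (12 * t) = Real.pi * Real.sqrt (n / 3) := by
    have hsq3 : Real.sqrt ((n : ℝ) / 3) = s / 3 := by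
      rw [hs, show (3 : ℝ) * n = (n / 3) * 3 ^ 2 by ring, Real.sqrt_mul (by positivity),
        Real.sqrt_sq (by norm_num)]
      ring
    rw [hsq3, ht]
    field_simp
    nlinarith [hss, Real.pi_pos]
  have hxn0 : 0 < x ^ n := pow_pos hx0 n
  calc ((finsetsOfSumLE n).card : ℝ) = ((finsetsOfSumLE n).card : ℝ) * x ^ n / x ^ n := by
        field_simp
    _ ≤ Real.exp (Real.pi ^ 2 / (12 * t)) / x ^ n :=
        div_le_div_of_nonneg_right (hlow.trans hprod) hxn0.le
    _ = Real.exp (Real.pi * Real.sqrt (n / 3)) := by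
        rw [hxn, ← Real.exp_sub, ← hkey]; ring_nf

/-- **`P_D(A) ≤ exp(π √(A/3))`** — the sharp exponential order of Hardy–Ramanujan's
`log P_D(A) ∼ π(A/3)^{1/2}`, upper half, for every `A`.
[cite: MadrasSlade1993, Theorem 3.1.4 (p. 58)] -/
theorem card_distinctPartitions_le_exp_sharp (A : ℕ) :
    ((distinctPartitions A).card : ℝ) ≤ Real.exp (Real.pi * Real.sqrt (A / 3)) := by
  calc ((distinctPartitions A).card : ℝ) ≤ (finsetsOfSumLE A).card := by
        exact_mod_cast Finset.card_le_card (distinctPartitions_subset A)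
    _ ≤ _ := card_finsetsOfSumLE_le_exp_sharp A

end Literature.Combinatorics.Enumerative

end
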